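import Mathlib.RingTheory.Nullstellensatz
import Literature.RingTheory.MvPolynomial.RuppertGaoSections
import HarnessLib

/-!
# Generic plane sections of non-associated irreducible factors are non-associated

Sibling of `RuppertGaoSections.lean` (irreducibility and degree of the generic plane section
`planeSect f = f(μ + vX + zY)` read over `Ω`, the algebraic closure of `K(z, μ, v)`; after
E. Kaltofen, J. Comput. System Sci. 50 (1995) 274–295, §5 Lemma 7). Here:

* `Ruppert.not_dvd_map_planeSect` — over an algebraically closed `K`, if `f₁, f₂` are
  irreducible with `f₁ ∤ f₂`, then the section of `f₁` does not divide that of `f₂` in `Ω[X, Y]`.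
  (Both sections are irreducible by Lemma 7; a unit quotient descends to
  `b · f₂(μ+vX+zY) = a · f₁(μ+vX+zY)` over `K[z, μ, v]`; specialising `X, Y ↦ 0` and
  `X ↦ 1, Y ↦ 0` gives `f₂(μ) f₁(μ+v) = f₁(μ) f₂(μ+v)`, so the prime `f₁(μ)` would divide
  `f₁(μ+v)` — evaluate at `μ = μ₀`, a zero of `f₁`, and `v = x₁ − μ₀`, `x₁` a non-zero of `f₁`.)

Used by the Gao–Ruppert count (`RuppertGaoRank.lean`): the sections of the distinct absolute
factors of `f` are then distinct irreducible factors of the section of `f`. No definitions, no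
named facts; helpers private.

## References

* E. Kaltofen, J. Comput. System Sci. 50 (1995) 274–295, §5 Lemma 7. [`Kaltofen1995`]
-/

noncomputable section

open MvPolynomial
open scoped Polynomial

universe u

namespace Literature.RingTheory.MvPolynomial

namespace Ruppert

open Literature.NumberTheory.DiophantineGeometry

variable {K : Type u} [Field K] {n : ℕ}

/-- `K[z, μ, v] → Ω` is injective. [folklore] -/
private theorem algebraMap_params_injective' :
    Function.Injective (algebraMap (MvPolynomial (Params n) K)
      (AlgebraicClosure (FractionRing (MvPolynomial (Params n) K)))) := by
  rw [IsScalarTower.algebraMap_eq (MvPolynomial (Params n) K) (FractionRing (MvPolynomial (Params n) K))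
    (AlgebraicClosure (FractionRing (MvPolynomial (Params n) K))), RingHom.coe_comp]
  exact (algebraMap (FractionRing (MvPolynomial (Params n) K)) _).injective.comp
    (IsFractionRing.injective (MvPolynomial (Params n) K) (FractionRing (MvPolynomial (Params n) K)))

/-! ### Non-association of the sections of non-associated factors -/

/-- A non-constant polynomial over an algebraically closed field has a zero (Nullstellensatz).
[folklore] -/
private theorem exists_eval_eq_zero [IsAlgClosed K] {f : MvPolynomial (Fin n) K}
    (hf : 0 < f.totalDegree) : ∃ x : Fin n → K, MvPolynomial.eval x f = 0 := by
  classical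
  by_contra h
  push Not at h
  have hzero : zeroLocus K (Ideal.span ({f} : Set (MvPolynomial (Fin n) K))) = ∅ := by
    ext x
    simp only [mem_zeroLocus_iff, Set.mem_empty_iff_false, iff_false, not_forall]
    exact ⟨f, Ideal.subset_span (Set.mem_singleton f), h x⟩
  have hrad := vanishingIdeal_zeroLocus_eq_radical (K := K) (Ideal.span ({f} : Set (MvPolynomial (Fin n) K)))
  rw [hzero, vanishingIdeal_empty, eq_comm, Ideal.radical_eq_top, Ideal.span_singleton_eq_top] at hrad
  have := (MvPolynomial.isUnit_iff_totalDegree_of_isReduced.mp hrad).2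
  omega

/-- A non-zero polynomial over an infinite field has a non-zero value. [folklore] -/
private theorem exists_eval_ne_zero [Infinite K] {f : MvPolynomial (Fin n) K} (hf : f ≠ 0) :
    ∃ x : Fin n → K, MvPolynomial.eval x f ≠ 0 := by
  by_contra h
  push Not at h
  exact hf (MvPolynomial.funext fun x => by rw [h x, map_zero])

/-- Specialising the generic section: `X, Y ↦ 0` gives `f(μ)`, `X ↦ 1, Y ↦ 0` gives `f(μ + v)`.
[folklore] -/
private theorem aeval_planeSect (s : Fin 2 → MvPolynomial (Params n) K) (f : MvPolynomial (Fin n) K) :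
    MvPolynomial.aeval s (planeSect f) = MvPolynomial.aeval (fun i =>
      (X (Sum.inr (Sum.inl i)) + X (Sum.inr (Sum.inr i)) * s 0 + X (Sum.inl i) * s 1 :
        MvPolynomial (Params n) K)) f := by
  have key : ((MvPolynomial.aeval s : MvPolynomial (Fin 2) (MvPolynomial (Params n) K) →ₐ[_] _).toRingHom).comp
      (eval₂Hom (C.comp C) (sectSubst (A := K) n)) =
      (MvPolynomial.aeval (fun i => (X (Sum.inr (Sum.inl i)) + X (Sum.inr (Sum.inr i)) * s 0 +
        X (Sum.inl i) * s 1 : MvPolynomial (Params n) K))).toRingHom := by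
    refine MvPolynomial.ringHom_ext (fun a => ?_) (fun i => ?_)
    · simp only [RingHom.coe_comp, Function.comp_apply, eval₂Hom_C, AlgHom.toRingHom_eq_coe,
        RingHom.coe_coe, MvPolynomial.algHom_C, MvPolynomial.algebraMap_eq, Algebra.algebraMap_self_apply]
    · simp only [RingHom.coe_comp, Function.comp_apply, eval₂Hom_X', AlgHom.toRingHom_eq_coe,
        RingHom.coe_coe, MvPolynomial.aeval_X, sectSubst, map_add, map_mul, MvPolynomial.algHom_C,
        Algebra.algebraMap_self_apply]
  exact DFunLike.congr_fun key f

/-- **Sections of non-associated irreducible factors are non-associated.** Over an algebraically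
closed field `K`: if `f₁, f₂` are irreducible with `f₁ ∤ f₂`, then the generic section of `f₁`
does not divide that of `f₂` in `Ω[X, Y]`. (A unit quotient descends to `b · f₂(μ+vX+zY) =
a · f₁(μ+vX+zY)` over `K[z, μ, v]`; specialising `X, Y ↦ 0` and `X ↦ 1, Y ↦ 0` gives
`f₂(μ) f₁(μ+v) = f₁(μ) f₂(μ+v)`, so the prime `f₁(μ)` would divide `f₁(μ+v)`: evaluate at
`μ = μ₀` a zero of `f₁` and `v = x₁ − μ₀`, `x₁` a non-zero of `f₁`.) [cite: Kaltofen1995, §5 Lemma 7 (consequence)] -/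
theorem not_dvd_map_planeSect [IsAlgClosed K] {f₁ f₂ : MvPolynomial (Fin n) K}
    (hf₁ : Irreducible f₁) (hf₂ : Irreducible f₂) (h : ¬ f₁ ∣ f₂) :
    ¬ MvPolynomial.map (algebraMap (MvPolynomial (Params n) K)
        (AlgebraicClosure (FractionRing (MvPolynomial (Params n) K)))) (planeSect f₁) ∣
      MvPolynomial.map (algebraMap (MvPolynomial (Params n) K)
        (AlgebraicClosure (FractionRing (MvPolynomial (Params n) K)))) (planeSect f₂) := by
  classical
  set ι := algebraMap (MvPolynomial (Params n) K) (AlgebraicClosure (FractionRing (MvPolynomial (Params n) K)))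
    with hι
  have hιinj : Function.Injective ι := algebraMap_params_injective'
  intro hdvd
  -- both sections are irreducible, so the quotient is a unit `C u`
  have habs₂ : IsAbsIrreducible f₂ := irreducible_map_of_isAlgClosed _ hf₂
  have hS₂ := irreducible_map_planeSect (n := n) habs₂
  have habs₁ : IsAbsIrreducible f₁ := irreducible_map_of_isAlgClosed _ hf₁
  have hS₁ := irreducible_map_planeSect (n := n) habs₁
  obtain ⟨t, ht⟩ := hdvd
  have htu : IsUnit t := (hS₂.isUnit_or_isUnit ht).resolve_left hS₁.not_isUnit
  rw [MvPolynomial.isUnit_iff_totalDegree_of_isReduced] at htu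
  obtain ⟨u, hu⟩ : ∃ u, t = C u := ⟨_, (totalDegree_eq_zero_iff_eq_C).mp htu.2⟩
  -- descend: `C b · planeSect f₂ = C a · planeSect f₁` over `K[z, μ, v]`
  set P₁ := planeSect f₁ with hP₁
  set P₂ := planeSect f₂ with hP₂
  have hP₁0 : P₁ ≠ 0 := by
    intro h0; apply hS₁.ne_zero; rw [h0, map_zero]
  obtain ⟨e₀, he₀⟩ := MvPolynomial.ne_zero_iff.mp hP₁0
  set a : MvPolynomial (Params n) K := coeff e₀ P₂ with ha
  set b : MvPolynomial (Params n) K := coeff e₀ P₁ with hb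
  have hcoeff : ∀ e, ι (coeff e P₂) = ι (coeff e P₁) * u := fun e => by
    have := congrArg (coeff e) ht
    rwa [coeff_map, hu, mul_comm, coeff_C_mul, mul_comm, coeff_map] at this
  have hu' : ι b * u = ι a := (hcoeff e₀).symm
  have hab : C b * P₂ = C a * P₁ := by
    refine MvPolynomial.ext _ _ fun e => hιinj ?_
    rw [coeff_C_mul, coeff_C_mul, map_mul, map_mul, hcoeff e, ← hu']
    ring
  have hb0 : b ≠ 0 := he₀
  have ha0 : a ≠ 0 := by
    intro ha0
    rw [ha0, C_0, zero_mul, mul_eq_zero] at hab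
    rcases hab with h1 | h1
    · exact hb0 (C_eq_zero.mp h1)
    · apply hS₂.ne_zero; rw [h1, map_zero]
  -- the two specialisations
  set μX : Fin n → MvPolynomial (Params n) K := fun i => X (Sum.inr (Sum.inl i)) with hμX
  set μvX : Fin n → MvPolynomial (Params n) K :=
    fun i => X (Sum.inr (Sum.inl i)) + X (Sum.inr (Sum.inr i)) with hμvX
  have hrn : MvPolynomial.aeval (fun i => (X (Sum.inr (Sum.inl i)) + X (Sum.inr (Sum.inr i)) *
      (fun _ : Fin 2 => (0 : MvPolynomial (Params n) K)) 0 + X (Sum.inl i) *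
        (fun _ : Fin 2 => (0 : MvPolynomial (Params n) K)) 1 : MvPolynomial (Params n) K)) =
      rename (fun i : Fin n => (Sum.inr (Sum.inl i) : Params n)) :=
    MvPolynomial.algHom_ext fun i => by simp
  have hg : ∀ f : MvPolynomial (Fin n) K, MvPolynomial.aeval (fun _ : Fin 2 => (0 : MvPolynomial (Params n) K))
      (planeSect f) = rename (fun i : Fin n => (Sum.inr (Sum.inl i) : Params n)) f := fun f => by
    rw [aeval_planeSect, hrn]
  have hfun1 : (fun i => (X (Sum.inr (Sum.inl i)) + X (Sum.inr (Sum.inr i)) *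
      (![1, 0] : Fin 2 → MvPolynomial (Params n) K) 0 + X (Sum.inl i) *
        (![1, 0] : Fin 2 → MvPolynomial (Params n) K) 1 : MvPolynomial (Params n) K)) = μvX := by
    funext i; simp [hμvX]
  have hh : ∀ f : MvPolynomial (Fin n) K, MvPolynomial.aeval (![1, 0] : Fin 2 → MvPolynomial (Params n) K)
      (planeSect f) = MvPolynomial.aeval μvX f := fun f => by
    rw [aeval_planeSect, hfun1]
  set g₁ := rename (fun i : Fin n => (Sum.inr (Sum.inl i) : Params n)) f₁ with hg₁
  set g₂ := rename (fun i : Fin n => (Sum.inr (Sum.inl i) : Params n)) f₂ with hg₂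
  set h₁ := MvPolynomial.aeval μvX f₁ with hh₁
  set h₂ := MvPolynomial.aeval μvX f₂ with hh₂
  have hemb : Function.Injective (fun i : Fin n => (Sum.inr (Sum.inl i) : Params n)) :=
    Sum.inr_injective.comp Sum.inl_injective
  have e1 : b * g₂ = a * g₁ := by
    have := congrArg (MvPolynomial.aeval (fun _ : Fin 2 => (0 : MvPolynomial (Params n) K))) hab
    rwa [map_mul, map_mul, MvPolynomial.algHom_C, MvPolynomial.algHom_C, Algebra.algebraMap_self_apply,
      Algebra.algebraMap_self_apply, hg, hg, ← hg₁, ← hg₂] at this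
  have e2 : b * h₂ = a * h₁ := by
    have := congrArg (MvPolynomial.aeval (![1, 0] : Fin 2 → MvPolynomial (Params n) K)) hab
    rwa [map_mul, map_mul, MvPolynomial.algHom_C, MvPolynomial.algHom_C, Algebra.algebraMap_self_apply,
      Algebra.algebraMap_self_apply, hh, hh, ← hh₁, ← hh₂] at this
  have e3 : g₂ * h₁ = g₁ * h₂ := by
    have h3 : a * b * (g₂ * h₁) = a * b * (g₁ * h₂) := by
      calc a * b * (g₂ * h₁) = (b * g₂) * (a * h₁) := by ring
        _ = (a * g₁) * (b * h₂) := by rw [e1, e2]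
        _ = a * b * (g₁ * h₂) := by ring
    exact mul_left_cancel₀ (mul_ne_zero ha0 hb0) h3
  -- `g₁ = f₁(μ)` is a prime not dividing `g₂ = f₂(μ)`, hence divides `h₁ = f₁(μ + v)`
  have hg₁p : Prime g₁ := (NoetherForms.irreducible_rename hemb hf₁).prime
  have hndvd : ¬ g₁ ∣ g₂ := by
    rintro ⟨t', ht'⟩
    apply h
    refine ⟨MvPolynomial.aeval (Function.extend (fun i : Fin n => (Sum.inr (Sum.inl i) : Params n))
      MvPolynomial.X 0) t', ?_⟩
    have := congrArg (MvPolynomial.aeval (Function.extend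
      (fun i : Fin n => (Sum.inr (Sum.inl i) : Params n)) MvPolynomial.X
        (0 : Params n → MvPolynomial (Fin n) K))) ht'
    rwa [map_mul, hg₂, hg₁, NoetherForms.aeval_extend_rename hemb, NoetherForms.aeval_extend_rename hemb]
      at this
  have hdvd₁ : g₁ ∣ h₁ := by
    have : g₁ ∣ g₂ * h₁ := ⟨h₂, e3⟩
    exact (hg₁p.dvd_or_dvd this).resolve_left hndvd
  obtain ⟨t', ht'⟩ := hdvd₁
  -- evaluate at `μ = μ₀` (a zero of `f₁`), `v = x₁ − μ₀` (`x₁` a non-zero of `f₁`)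
  have hf₁pos : 0 < f₁.totalDegree := by
    by_contra h0
    have h0' : f₁.totalDegree = 0 := by omega
    by_cases hc : coeff 0 f₁ = 0
    · apply hf₁.ne_zero; rw [totalDegree_eq_zero_iff_eq_C] at h0'; rw [h0', hc, C_0]
    · exact hf₁.not_isUnit (MvPolynomial.isUnit_iff_totalDegree_of_isReduced.mpr
        ⟨(Ne.isUnit hc), h0'⟩)
  obtain ⟨μ₀, hμ₀⟩ := exists_eval_eq_zero hf₁pos
  obtain ⟨x₁, hx₁⟩ := exists_eval_ne_zero (f := f₁) hf₁.ne_zero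
  set pt : Params n → K := Sum.elim (fun _ => 0) (Sum.elim μ₀ (fun i => x₁ i - μ₀ i)) with hpt
  have hev₁ : MvPolynomial.eval pt g₁ = 0 := by
    rw [hg₁, eval_rename]
    have : (pt ∘ fun i : Fin n => (Sum.inr (Sum.inl i) : Params n)) = μ₀ := by
      funext i; simp [hpt]
    rw [this, hμ₀]
  have hev₂ : MvPolynomial.eval pt h₁ = MvPolynomial.eval x₁ f₁ := by
    have hc := MvPolynomial.comp_aeval_apply (f := μvX) (MvPolynomial.aeval pt) f₁
    have hfun : (fun i => MvPolynomial.aeval pt (μvX i)) = x₁ := by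
      funext i; simp [hμvX, hpt]
    rw [hfun] at hc
    rw [hh₁, ← coe_aeval_eq_eval, ← coe_aeval_eq_eval]
    exact hc
  have : MvPolynomial.eval pt h₁ = 0 := by rw [ht', map_mul, hev₁, zero_mul]
  rw [hev₂] at this
  exact hx₁ this


end Ruppert

end Literature.RingTheory.MvPolynomial

end
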